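import Literature.NumberTheory.Automorphic.GodementJacquetRankOne
import Literature.NumberTheory.Automorphic.GodementJacquetZetaIntegralsProofs
import Literature.NumberTheory.Automorphic.PairLFunctionMeromorphicContinuationNeConjProofs
import Literature.NumberTheory.Automorphic.PairLFunctionMeromorphicContinuationRankNeTwistProofs
import HarnessLib

/-!
# Godement–Jacquet in rank one, entire case (Hecke–Tate): `L^S(s, χ)` is entire for `χ ≠ 1`;
# Mœglin–Waldspurger, Corollaire (i)(b) for `GL_1` over every number field

Topic `NumberTheory/Automorphic`; namespace `Literature.NumberTheory.Automorphic` (and three lemmas on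
levels in `Literature.NumberTheory.GaloisRepresentations.HeckeCharacter`). Proof file (theorems only:
no definition, no named fact, no instance) under the named fact
`MoeglinWaldspurger1989_partialPairL_entire_of_ne_conj` of `PairLFunctionMeromorphicContinuation`
(C. Mœglin, J.-L. Waldspurger, *Le spectre résiduel de `GL(n)`*, Ann. Sci. ÉNS (4) 22 (1989),
Appendice, Corollaire (i)(b), p. 667): its case `n = 1`, over EVERY number field, is now a theorem
of the tree (`MoeglinWaldspurger1989_partialPairL_entire_of_ne_conj_one`). In rank one the statement
is Hecke's: for cuspidal `π, π'` of `GL_1(𝔸_K)` (unitary idele class characters `χ, χ'` trivial on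
`A_G`) with `π ≠ π̄'`, i.e. `ψ = χχ' ≠ 1`, the partial Hecke `L`-function `L^S(s, ψ)` is entire
(Tate, *Fourier analysis in number fields and Hecke's zeta-functions*, in Cassels–Fröhlich (1967),
Ch. XV, Thm. 4.4.1, the case of a character non-trivial on the norm-one ideles). The previous
reductions took this as an input (`…_one_of_tate`, the named fact
`heckeLFunction_hasEntireContinuation_of_not_isNormTwist`; `…_one_rat` for `K = ℚ` from Dirichlet
`L`-functions). Here it is PROVED, from the Godement–Jacquet theory of the tree in rank one:

* `gjZeta_entire_continuation_fin_one_of_integral_mul_eq_zero` — **Tate's continuation, entire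
  case**: for `Φ ∈ 𝒮(𝔸_K)`, `φ, φ' ∈ L²(X)` with `(∫_X φ̄') (∫_X φ) = 0`, the zeta integral
  `Z(Φ, s, φ, φ')` of `GL_1` is represented on `Re s > 4` by an ENTIRE function — the polar part
  `E (λ⁻¹ Φ̂(0)/(s-1) - Φ(0)/s)` of `gjZeta_restrict_compl_fin_one_eq` (`GodementJacquetRankOne`) has
  coefficient `E = 0` (Tate's Lemma B);
* levels: `mul_ofLocal_toLocal_inv_mem_principalCongruenceLevel` (peeling the `v`-component of an
  element of `K(𝔫')`, `v ∤ 𝔫'`), `HeckeCharacter.exists_level_peel`,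
  `HeckeCharacter.exists_level_subset_of_isUnramifiedAt` (**a Hecke character unramified off `S`
  has a level `K(𝔫)`, through `det`, with the primes of `𝔫` in `S`** — Tate's "no small subgroups"
  level `exists_level`, its primes outside `S` peeled off one at a time),
  `exists_isOpen_level_subset_of_invariant` (product neighbourhoods of `1` with level supported on
  `S`, for neighbourhoods invariant under `ι_v(GL_n(𝒪_v))`, `v ∉ S`);
* `GL_1`: `CuspidalAutomorphicRepGL.rightRegular_apply_eq_heckeCharacter_det_smul`
  (`R(g) φ = χ_Π(det g) φ` on `Π`), `…rightRegular_ofLocal_apply_eq_self`,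
  `…rightRegular_apply_eq_self_of_mem_awayLevel` (**`Π` is `K^S`-spherical when `χ_Π` is unramified
  off `S`**), `…integral_eq_zero_of_heckeCharacter_ne_one` (**`∫_X φ = 0` for `φ ∈ Π`, `χ_Π ≠ 1`**,
  by invariance of `μ`);
* `exists_unfolding_data_at`, `re_placesZeta_pos_at` — the data of the `K^T`-spherical unfolding
  (`GJUnfoldingData`) adapted to a COMPLEX point `s₀` and with level supported exactly on `S`: the
  local zeta integral `Z_S(s) = ∫_{G_S} Φ_G ⟪φ, R φ⟫ |det|^s` is entire and `Re Z_S(s₀) > 0`;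
* `exists_entire_eq_mul_partialStandardL_fin_one` — the zeta quotient at a point:
  `Z = A · L^S(s, Π)` on `Re s > 4` with `Z`, `A` entire and `A(s₀) ≠ 0`
  (`gjZeta_awayProductMeasure_eq`, Godement–Jacquet's factorisation without the tensor-product
  theorem; for `GL_1` this is Tate §4.5, `ζ(f, c) = ∏_{𝔭 ∈ S} ζ_𝔭 · ∏_{𝔭 ∉ S} … · ζ(s, χ)`);
* `hasEntireContinuation_partialStandardL_gl_one` (**main**) — for cuspidal `Π` of `GL_1(𝔸_K)` with
  `χ_Π ≠ 1`, every finite `S` and honest Satake family `γ` off `S`, `L^S(s, Π)` is entire: the entire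
  functions `Z_t A_{t'}` and `Z_{t'} A_t` agree on `Re s > 4`, hence everywhere, so
  `s ↦ Z_s(s)/A_s(s)` is entire and equals `L^S` on `Re s > 4`, hence on `Re s > 1`
  (`differentiableOn_partialStandardL_of_summable` with Jacquet–Shalika's (5.3.3));
* `exists_entire_eq_partialHeckeL` — **Hecke's theorem** for unitary `ψ ≠ 1` trivial on `A_G`:
  `L^S(s, ψ)` is entire (`ψ = χ_Π`, `CuspidalAutomorphicRepGL.exists_heckeCharacter_eq`);
* `MoeglinWaldspurger1989_partialPairL_entire_of_ne_conj_one` — **the named fact for `n = 1` over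
  `K`**, unconditionally (`…_one_of_heckeCharacter` of `PairLFunctionMeromorphicContinuationNeConjProofs`).

What is NOT here: the named fact `heckeLFunction_hasEntireContinuation_of_not_isNormTwist` itself
(all unitary characters which are not norm twists, the full Euler product off the ramified places:
it follows from `exists_entire_eq_partialHeckeL` by the shift `χ = ψ ‖·‖^{it}` and an auxiliary
automorphic measure, in its own file), and ranks `n ≥ 2` of Corollaire (i)(b).

## References

* C. Mœglin, J.-L. Waldspurger, *Le spectre résiduel de `GL(n)`*, Ann. Sci. École Norm. Sup. (4)
  22 (1989), 605–674: Appendice, Corollaire (i)(b), p. 667. [MoeglinWaldspurger1989]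
* J. Tate, *Fourier analysis in number fields and Hecke's zeta-functions* (1950), in
  Cassels–Fröhlich, *Algebraic Number Theory* (1967), Ch. XV, Thm. 4.4.1 with Lemma B, and §4.5.
  [TateThesis1967]
* R. Godement, H. Jacquet, *Zeta functions of simple algebras*, LNM 260 (1972), §§12–13,
  Thm. 13.8. [GodementJacquet1972]
-/

noncomputable section

open MeasureTheory Measure Set Filter Topology IsDedekindDomain NumberField NumberField.mixedEmbedding
open Literature.MeasureTheory.Group
open scoped ENNReal NNReal ComplexConjugate MatrixGroups InnerProductSpace Classical Pointwise

namespace Literature.NumberTheory.Automorphic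

-- the quotient carries the tree's Borel σ-algebra, not Mathlib's quotient σ-algebra
attribute [-instance] Quotient.instMeasurableSpace QuotientGroup.measurableSpace

/-! ### The zeta integral of `GL_1` is entire when the polar coefficient vanishes -/

section EntireContinuation

variable {K : Type} [Field K] [NumberField K]

attribute [local instance] adelicBorel borelSpace_adelic locallyCompactSpace_adelic
  secondCountableTopology_gl_adelic measurableSpaceQuotient borelSpaceQuotient glBorel borelSpace_glBorel
  isHaarMeasure_glForm smulInvariantMeasureQuotient isFiniteMeasureOnCompactsQuotient
  secondCountableTopology_adeleRing locallyCompactSpace_adeleRing'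

/-- **The Godement–Jacquet zeta integral of `GL_1` is entire when `(∫ φ̄') (∫ φ) = 0`** (Tate: the
zeta function `ζ(f, c)` of a character `c` non-trivial on the norm-one ideles is entire). For
`Φ ∈ 𝒮(𝔸_K)`, `φ, φ' ∈ L²(X)`, an automorphic measure `μ` and a Haar measure `ν` on `GL_1(𝔸_K)`, the
zeta integral `Z(Φ, s, φ, φ')` converges absolutely for `Re s > 4` and, if
`(∫_X conj φ' dμ) (∫_X φ dμ) = 0`, is represented there by the ENTIRE function
`Z^{≥1}(s) + λ(D)⁻¹ ∫_G Φ̂(g⁻¹) |g|^{s-1} 𝟙_{|g|<1} ⟪φ', R(g) φ⟫ dg` — the polar part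
`E (λ(D)⁻¹ Φ̂(0)/(s-1) - Φ(0)/s)` of `gjZeta_restrict_compl_fin_one_eq` has coefficient `E = 0`.
Godement–Jacquet (1972), Thm. 13.8 for `n = 1`; Tate (1967), Thm. 4.4.1 (the case "`c` non-trivial on
`J`", Lemma B). [cite: GodementJacquet1972, Thm. 13.8] [cite: TateThesis1967, Thm. 4.4.1] -/
theorem gjZeta_entire_continuation_fin_one_of_integral_mul_eq_zero
    (μ : Measure (AdelicGroupData.gl 1 K).automorphicQuotient) [(AdelicGroupData.gl 1 K).IsAutomorphicMeasure μ]
    {Φ : Matrix (Fin 1) (Fin 1) (AdeleRing (𝓞 K) K) → ℂ} (hΦ : Φ ∈ schwartzBruhatAdelicMatrix 1 K)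
    (φ φ' : (AdelicGroupData.gl 1 K).L2 μ)
    (h0 : (∫ x, conj ((φ' : (AdelicGroupData.gl 1 K).automorphicQuotient → ℂ) x) ∂μ) *
      (∫ x, (φ : (AdelicGroupData.gl 1 K).automorphicQuotient → ℂ) x ∂μ) = 0)
    (ν : Measure (AdelicGroupData.gl 1 K).Adelic) [ν.IsHaarMeasure] :
    (∀ s : ℂ, (4 : ℝ) < s.re → Integrable (gjZetaIntegrand μ Φ φ φ' s) ν) ∧
      ∃ g : ℂ → ℂ, Differentiable ℂ g ∧ ∀ s : ℂ, (4 : ℝ) < s.re → g s = gjZeta μ ν Φ φ φ' s := by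
  -- Borel structures and Haar measures on `𝔸_K` and `M_1(𝔸_K)`
  letI mA : MeasurableSpace (AdeleRing (𝓞 K) K) := borel _
  haveI : BorelSpace (AdeleRing (𝓞 K) K) := ⟨rfl⟩
  letI mM : MeasurableSpace (Matrix (Fin 1) (Fin 1) (AdeleRing (𝓞 K) K)) := borel _
  haveI : BorelSpace (Matrix (Fin 1) (Fin 1) (AdeleRing (𝓞 K) K)) := ⟨rfl⟩
  haveI : LocallyCompactSpace (Matrix (Fin 1) (Fin 1) (AdeleRing (𝓞 K) K)) :=
    Pi.locallyCompactSpace_of_finite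
  set lam : Measure (Matrix (Fin 1) (Fin 1) (AdeleRing (𝓞 K) K)) := Measure.addHaar with hlam
  -- a Bruhat function of `H = A_G · GL_1(K)`
  obtain ⟨β, hβ⟩ := exists_isBruhatFunction (AdelicGroupData.gl 1 K).quotientSubgroup (quotientSubgroupHaar 1 K)
    inferInstance
  -- Haar measure on `A_G`, inversion invariant (`A_G` is commutative)
  set α : Measure (AdelicGroupData.gl 1 K).center' := Measure.haar with hαdef
  haveI : IsMulCommutative ℝ≥0ˣ := ⟨⟨mul_comm⟩⟩
  haveI : IsMulCommutative (AdelicGroupData.gl 1 K).center' := Subgroup.range_isMulCommutative (posRealScalar 1 K)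
  haveI : α.IsInvInvariant := by
    open scoped IsMulCommutative in exact IsHaarMeasure.isInvInvariant_of_regular α
  obtain ⟨κ, -, hκ⟩ := exists_map_quotientSubgroupEquiv_eq_smul_prod (quotientSubgroupHaar 1 K) α
  obtain ⟨cα, -, hα⟩ := exists_map_centerLog_eq_smul_volume (n := 1) Nat.one_pos α
  -- the abscissa and absolute convergence
  have hΦc : Continuous fun x : GL (Fin 1) (AdeleRing (𝓞 K) K) => Φ (x : Matrix (Fin 1) (Fin 1) (AdeleRing (𝓞 K) K)) :=
    (continuous_of_mem_schwartzBruhatAdelicMatrix hΦ).comp Units.continuous_val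
  have hmaj : ∀ σ : ℝ, (4 : ℝ) ≤ σ → Integrable (fun x : GL (Fin 1) (AdeleRing (𝓞 K) K) =>
      ‖Φ (x : Matrix (Fin 1) (Fin 1) (AdeleRing (𝓞 K) K))‖ * (adelicAbsDet 1 K x : ℝ) ^ σ)
      (ν : Measure (GL (Fin 1) (AdeleRing (𝓞 K) K))) := fun σ hσ =>
    integrable_norm_mul_adelicAbsDet_rpow_of_mem_schwartzBruhat (ν : Measure (GL (Fin 1) (AdeleRing (𝓞 K) K))) hΦ
      (by norm_num; linarith)
  have hint : ∀ s : ℂ, (4 : ℝ) < s.re → Integrable (gjZetaIntegrand μ Φ φ φ' s) ν := fun s hs =>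
    integrable_gjZetaIntegrand_of_integrable_norm_mul_rpow
      (aestronglyMeasurable_gjZetaIntegrand hΦc φ φ' s _) (hmaj s.re hs.le)
  -- the two entire pieces
  set L : ℂ := ((lam (matrixFundamentalDomain 1 K)).toReal : ℂ)⁻¹ with hL
  set gZ : ℂ → ℂ := gjZeta μ ((ν : Measure (GL (Fin 1) (AdeleRing (𝓞 K) K))).restrict (detAtLeastOne 1 K)) Φ φ φ' with hgZ
  set gM : ℂ → ℂ := fun s => ∫ g : GL (Fin 1) (AdeleRing (𝓞 K) K),
    gjDualF 1 K (adelicMatrixFourier 1 K lam Φ) (((1 : ℕ) : ℂ) - s) g⁻¹ * glMatrixCoeff μ φ φ' g ∂ν with hgM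
  have hgZd : Differentiable ℂ gZ :=
    differentiable_gjZeta_restrict_detAtLeastOne hΦc φ φ' (x₀ := 4) fun σ hσ => hmaj σ hσ.le
  have hgMd : Differentiable ℂ gM :=
    differentiable_integral_gjDualF_inv_mul_glMatrixCoeff μ (adelicMatrixFourier_mem_schwartzBruhatAdelicMatrix lam hΦ) φ φ' ν
  refine ⟨hint, fun s => gZ s + L * gM s, hgZd.add (hgMd.const_mul L), fun s hs => ?_⟩
  -- agreement on `Re s > 4`
  rw [gjZeta_eq_restrict_add_restrict_compl (ν : Measure (GL (Fin 1) (AdeleRing (𝓞 K) K))) (hint s hs)]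
  change gZ s + _ = gZ s + gjZeta μ (ν.restrict (detAtLeastOne 1 K)ᶜ) Φ φ φ' s
  congr 1
  have h := gjZeta_restrict_compl_fin_one_eq lam μ ν hΦ φ φ' (s := s) hs.le hβ hκ hα
  rw [sub_eq_iff_eq_add] at h
  rw [h, mul_assoc (_ * _ * _) _ _, h0, mul_zero, zero_add]

end EntireContinuation

end Literature.NumberTheory.Automorphic

/-! ### Peeling one place off a principal congruence subgroup -/

namespace Literature.NumberTheory.Automorphic

variable {n : ℕ} {K : Type} [Field K] [NumberField K]

/-- **Peeling the `v`-component.** If `k ∈ K(𝔫')` with `𝔫' ≠ 0` prime to `v`, then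
`k · ι_v(k_v)⁻¹ ∈ K(𝔭_v^e 𝔫')` for every `e`: it is `1` at `v` and equals `k` at `w ≠ v`, where
`|𝔭_v^e 𝔫'|_w = |𝔫'|_w` (`idealRadius_pow_mul_of_ne`). This is the computation inside
`exists_principalCongruenceLevel_not_dvd_mul_ofLocal_inv_mem` (Bump §3.3:
`K(𝔫) = GL_n(𝒪_v) · K(𝔫)^{(v)}` for `v ∤ 𝔫`). [folklore] -/
theorem mul_ofLocal_toLocal_inv_mem_principalCongruenceLevel {𝔫' : Ideal (𝓞 K)} (h𝔫' : 𝔫' ≠ 0)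
    {v : HeightOneSpectrum (𝓞 K)} (hv𝔫' : ¬ v.asIdeal ∣ 𝔫') (e : ℕ)
    {k : GL (Fin n) (AdeleRing (𝓞 K) K)} (hk : k ∈ principalCongruenceLevel n K 𝔫') :
    k * (GLn.ofLocal n K v ((AdelicGroupData.gl n K).toLocal v k))⁻¹ ∈
      principalCongruenceLevel n K (v.asIdeal ^ e * 𝔫') := by
  set s : GL (Fin n) (AdeleRing (𝓞 K) K) :=
    GLn.ofLocal n K v ((AdelicGroupData.gl n K).toLocal v k) with hs
  obtain ⟨hkint, hkw⟩ := mem_principalCongruenceLevel_iff.mp hk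
  have hkv : (AdelicGroupData.gl n K).toLocal v k ∈
      valuedCongruenceSubgroup (Fin n) (1 : WithZero (Multiplicative ℤ)) :=
    toLocal_mem_valuedCongruenceSubgroup_one hkint v
  have hsK : s ∈ principalCongruenceLevel n K 𝔫' :=
    isMaximalAt_principalCongruenceLevel n K v h𝔫' hv𝔫' ⟨_, hkv, rfl⟩
  rw [mem_principalCongruenceLevel_iff]
  refine ⟨(glIntegralLevel n K).mul_mem hkint
    ((glIntegralLevel n K).inv_mem (principalCongruenceLevel_le n K 𝔫' hsK)), fun w => ?_⟩
  show Matrix.GeneralLinearGroup.map (AdelicGroupData.adeleEval K w) (k * s⁻¹) ∈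
    valuedCongruenceSubgroup (Fin n) (idealRadius K w (v.asIdeal ^ e * 𝔫'))
  rw [map_mul, map_inv]
  by_cases hw : w = v
  · subst hw
    rw [hs, GLn.map_adeleEval_ofLocal]
    show (AdelicGroupData.gl n K).toLocal w k * ((AdelicGroupData.gl n K).toLocal w k)⁻¹ ∈ _
    rw [mul_inv_cancel]
    exact one_mem _
  · have h1 : Matrix.GeneralLinearGroup.map (AdelicGroupData.adeleEval K w) s = 1 :=
      GLn.toLocal_ofLocal_of_ne hw _
    rw [h1, inv_one, mul_one, idealRadius_pow_mul_of_ne K hw e h𝔫']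
    exact hkw w

/-- `ι_v(x) ∈ K^max` for `x ∈ GL_n(𝒪_v)` (`isMaximalAt_glIntegralLevel`). [folklore] -/
theorem ofLocal_mem_glIntegralLevel_of_mem {v : HeightOneSpectrum (𝓞 K)} {x : GL (Fin n) (v.adicCompletion K)}
    (hx : x ∈ valuedCongruenceSubgroup (Fin n) (1 : WithZero (Multiplicative ℤ))) :
    GLn.ofLocal n K v x ∈ glIntegralLevel n K :=
  isMaximalAt_glIntegralLevel n K v ⟨x, hx, rfl⟩

/-- The archimedean matrix of `ι_v(x)`, `x ∈ GL_n(𝒪_v)`, is `1`. [folklore] -/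
theorem toMixed_ofLocal_of_mem {v : HeightOneSpectrum (𝓞 K)} {x : GL (Fin n) (v.adicCompletion K)}
    (hx : x ∈ valuedCongruenceSubgroup (Fin n) (1 : WithZero (Multiplicative ℤ))) :
    GLn.toMixed n K (GLn.ofLocal n K v x) = 1 := by
  rw [← GLn.ofFinite_sndHom_of_mem (ofLocal_mem_glIntegralLevel_of_mem hx), GLn.toMixed_ofFinite]

/-- **Level subsets of an invariant neighbourhood, with primes in `S`.** Let `U` be a neighbourhood
of `1` in `GL_n(𝔸_K)` which is stable under right multiplication by `ι_v(GL_n(𝒪_v))` for every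
finite `v ∉ S`. Then `U` contains all `g` whose archimedean matrix lies in a suitable open `V ∋ 1`
and whose finite part lies in a suitable `K(𝔫)`, `𝔫 ≠ 0` **with all prime divisors in `S`**
(`exists_isOpen_level_subset` gives some level; its primes outside `S` are peeled off one at a time:
`g = (g ι_v(g_v)⁻¹) ι_v(g_v)` with the first factor of the deeper level,
`mul_ofLocal_toLocal_inv_mem_principalCongruenceLevel`). [folklore] -/
theorem exists_isOpen_level_subset_of_invariant (S : Finset (HeightOneSpectrum (𝓞 K)))
    {U : Set (GL (Fin n) (AdeleRing (𝓞 K) K))} (hU : U ∈ 𝓝 (1 : GL (Fin n) (AdeleRing (𝓞 K) K)))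
    (hinv : ∀ v ∉ S, ∀ x ∈ valuedCongruenceSubgroup (Fin n) (1 : WithZero (Multiplicative ℤ)),
      ∀ g ∈ U, g * GLn.ofLocal n K v x ∈ U) :
    ∃ V : Set (Matrix (Fin n) (Fin n) (mixedSpace K)), IsOpen V ∧
      (1 : Matrix (Fin n) (Fin n) (mixedSpace K)) ∈ V ∧
      ∃ 𝔫 : Ideal (𝓞 K), 𝔫 ≠ 0 ∧ (∀ w : HeightOneSpectrum (𝓞 K), w.asIdeal ∣ 𝔫 → w ∈ S) ∧
        ∀ g : GL (Fin n) (AdeleRing (𝓞 K) K),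
          ((GLn.toMixed n K g : GL (Fin n) (mixedSpace K)) : Matrix (Fin n) (Fin n) (mixedSpace K)) ∈ V →
            GLn.ofFinite n K (GLn.sndHom n K g) ∈ principalCongruenceLevel n K 𝔫 → g ∈ U := by
  classical
  obtain ⟨V, hV, h1V, 𝔫₀, h𝔫₀, hVU⟩ := exists_isOpen_level_subset n K hU
  refine ⟨V, hV, h1V, ?_⟩
  -- peel off, one at a time, the primes of a finite set `F` disjoint from `S`
  have key : ∀ F : Finset (HeightOneSpectrum (𝓞 K)), (∀ v ∈ F, v ∉ S) →
      ∃ 𝔫 : Ideal (𝓞 K), 𝔫 ≠ 0 ∧ (∀ v ∈ F, ¬ v.asIdeal ∣ 𝔫) ∧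
        (∀ w : HeightOneSpectrum (𝓞 K), w.asIdeal ∣ 𝔫 → w.asIdeal ∣ 𝔫₀) ∧
        ∀ g : GL (Fin n) (AdeleRing (𝓞 K) K),
          ((GLn.toMixed n K g : GL (Fin n) (mixedSpace K)) : Matrix (Fin n) (Fin n) (mixedSpace K)) ∈ V →
            GLn.ofFinite n K (GLn.sndHom n K g) ∈ principalCongruenceLevel n K 𝔫 → g ∈ U := by
    intro F
    refine Finset.induction_on F (fun _ => ⟨𝔫₀, h𝔫₀, fun v hv => absurd hv (Finset.notMem_empty v),
      fun w hw => hw, hVU⟩) ?_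
    intro v F hvF ih hF
    obtain ⟨𝔫, h𝔫, hF𝔫, hdiv, hU𝔫⟩ := ih fun u hu => hF u (Finset.mem_insert_of_mem hu)
    have hvS : v ∉ S := hF v (Finset.mem_insert_self v F)
    obtain ⟨e, 𝔫', hv𝔫', h𝔫eq⟩ := WfDvdMonoid.max_power_factor h𝔫 v.irreducible
    have h𝔫' : 𝔫' ≠ 0 := by
      rintro rfl
      exact h𝔫 (by rw [h𝔫eq, mul_zero])
    refine ⟨𝔫', h𝔫', fun u hu => ?_, fun w hw => hdiv w (h𝔫eq ▸ dvd_mul_of_dvd_right hw _),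
      fun g hgV hgf => ?_⟩
    · rcases Finset.mem_insert.mp hu with rfl | hu
      · exact hv𝔫'
      · exact fun h => hF𝔫 u hu (h𝔫eq ▸ dvd_mul_of_dvd_right h _)
    -- peel the `v`-component of the finite part of `g`
    set kf : GL (Fin n) (AdeleRing (𝓞 K) K) := GLn.ofFinite n K (GLn.sndHom n K g) with hkf
    set x : GL (Fin n) (v.adicCompletion K) := (AdelicGroupData.gl n K).toLocal v kf with hx
    set t : GL (Fin n) (AdeleRing (𝓞 K) K) := GLn.ofLocal n K v x with ht
    have hkint : kf ∈ glIntegralLevel n K := principalCongruenceLevel_le n K 𝔫' hgf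
    have hxv : x ∈ valuedCongruenceSubgroup (Fin n) (1 : WithZero (Multiplicative ℤ)) :=
      toLocal_mem_valuedCongruenceSubgroup_one hkint v
    have htint : t ∈ glIntegralLevel n K := ofLocal_mem_glIntegralLevel_of_mem hxv
    have hmem : kf * t⁻¹ ∈ principalCongruenceLevel n K 𝔫 := by
      rw [h𝔫eq]
      exact mul_ofLocal_toLocal_inv_mem_principalCongruenceLevel h𝔫' hv𝔫' e hgf
    -- `g t⁻¹ ∈ U` by the induction hypothesis
    have htM : GLn.toMixed n K t = 1 := toMixed_ofLocal_of_mem hxv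
    have h1 : g * t⁻¹ ∈ U := by
      refine hU𝔫 (g * t⁻¹) ?_ ?_
      · rw [map_mul, map_inv, htM, inv_one, mul_one]
        exact hgV
      · have e1 : GLn.ofFinite n K (GLn.sndHom n K (g * t⁻¹)) = kf * t⁻¹ := by
          rw [map_mul, map_inv, map_mul, map_inv, ← hkf, GLn.ofFinite_sndHom_of_mem htint]
        rw [e1]
        exact hmem
    -- `g = (g t⁻¹) t ∈ U` by invariance
    have h2 := hinv v hvS x hxv (g * t⁻¹) h1
    rwa [inv_mul_cancel_right] at h2
  obtain ⟨𝔫, h𝔫, hF, hdiv, hU𝔫⟩ :=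
    key ((primesOf h𝔫₀).filter fun v => v ∉ S) fun v hv => (Finset.mem_filter.mp hv).2
  refine ⟨𝔫, h𝔫, fun w hw => ?_, hU𝔫⟩
  by_contra hwS
  exact hF w (Finset.mem_filter.mpr ⟨(mem_primesOf_iff h𝔫₀).mpr (hdiv w hw), hwS⟩) hw

end Literature.NumberTheory.Automorphic

/-! ### Levels of a Hecke character supported on a prescribed finite set of places -/

namespace Literature.NumberTheory.GaloisRepresentations.HeckeCharacter

open Literature.NumberTheory.Automorphic

variable {K : Type} [Field K] [NumberField K]

/-- **Peeling one place off a level.** Let `χ (det k) = 1` for all `k` in the principal congruence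
subgroup `K(𝔫) ≤ GL_n(𝔸_K)` (`𝔫 ≠ 0`) and let `χ` be unramified at `v`. Write `𝔫 = 𝔭_v^e 𝔫'` with
`𝔭_v ∤ 𝔫'` (Mathlib `WfDvdMonoid.max_power_factor`). Then `χ (det k) = 1` on `K(𝔫')`: for `k ∈ K(𝔫')`,
`k = (k ι_v(k_v)⁻¹) · ι_v(k_v)` with `k ι_v(k_v)⁻¹ ∈ K(𝔫)` (it is `1` at `v` and equals `k` at `w ≠ v`,
where `|𝔫|_w = |𝔫'|_w`, `idealRadius_pow_mul_of_ne`) and `χ (det ι_v(k_v)) = χ(⟨det k_v⟩_v) = 1`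
(`det k_v ∈ 𝒪_vˣ`, `χ` unramified at `v`). (Bump §3.3: `K(𝔫) = GL_n(𝒪_v) K(𝔫)^{(v)}` for `v ∤ 𝔫`;
Tate (1967), Ch. XV, §2.) [folklore] -/
theorem exists_level_peel (n : ℕ) (χ : HeckeCharacter K) {𝔫 : Ideal (𝓞 K)} (h𝔫 : 𝔫 ≠ 0)
    (hχ : ∀ k ∈ principalCongruenceLevel n K 𝔫, χ (Matrix.GeneralLinearGroup.det k) = 1)
    {v : HeightOneSpectrum (𝓞 K)} (hv : χ.IsUnramifiedAt v) :
    ∃ 𝔫' : Ideal (𝓞 K), 𝔫' ≠ 0 ∧ ¬ v.asIdeal ∣ 𝔫' ∧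
      (∀ w : HeightOneSpectrum (𝓞 K), w.asIdeal ∣ 𝔫' → w.asIdeal ∣ 𝔫) ∧
      ∀ k ∈ principalCongruenceLevel n K 𝔫', χ (Matrix.GeneralLinearGroup.det k) = 1 := by
  obtain ⟨e, 𝔫', hv𝔫', h𝔫eq⟩ := WfDvdMonoid.max_power_factor h𝔫 v.irreducible
  have h𝔫' : 𝔫' ≠ 0 := by
    rintro rfl
    exact h𝔫 (by rw [h𝔫eq, mul_zero])
  refine ⟨𝔫', h𝔫', hv𝔫', fun w hw => h𝔫eq ▸ dvd_mul_of_dvd_right hw _, fun k hk => ?_⟩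
  set s : GL (Fin n) (AdeleRing (𝓞 K) K) :=
    GLn.ofLocal n K v ((AdelicGroupData.gl n K).toLocal v k) with hs
  have hkv : (AdelicGroupData.gl n K).toLocal v k ∈
      valuedCongruenceSubgroup (Fin n) (1 : WithZero (Multiplicative ℤ)) :=
    toLocal_mem_valuedCongruenceSubgroup_one (principalCongruenceLevel_le n K 𝔫' hk) v
  -- `k s⁻¹ ∈ K(𝔫)`
  have hmem : k * s⁻¹ ∈ principalCongruenceLevel n K 𝔫 := by
    rw [h𝔫eq]
    exact mul_ofLocal_toLocal_inv_mem_principalCongruenceLevel h𝔫' hv𝔫' e hk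
  -- `χ (det s) = 1`
  have hdet : χ (Matrix.GeneralLinearGroup.det s) = 1 := by
    rw [hs, GLn.det_ofLocal]
    exact hv.map_localUnits_eq_one _ (valued_det_eq_one_of_mem_valuedCongruenceSubgroup hkv)
  have e1 : k = k * s⁻¹ * s := by rw [inv_mul_cancel_right]
  calc χ (Matrix.GeneralLinearGroup.det k)
      = χ (Matrix.GeneralLinearGroup.det (k * s⁻¹ * s)) := by rw [← e1]
    _ = χ (Matrix.GeneralLinearGroup.det (k * s⁻¹)) * χ (Matrix.GeneralLinearGroup.det s) := by
        rw [map_mul, map_mul]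
    _ = 1 := by rw [hχ _ hmem, hdet, mul_one]

/-- **A Hecke character unramified off `S` has a level supported on `S`.** If `χ` is unramified at
every finite place outside the finite set `S`, then for every `n` there is `𝔫 ≠ 0`, all of whose
prime divisors lie in `S`, with `χ (det k) = 1` for all `k ∈ K(𝔫) ≤ GL_n(𝔸_K)`: start from any level
(`exists_level`, Tate's "no small subgroups") and peel off its primes outside `S` one at a time
(`exists_level_peel`). (Tate (1967), Ch. XV, §2: the conductor of a character is supported on its
ramified primes.) [folklore] -/
theorem exists_level_subset_of_isUnramifiedAt (n : ℕ) (χ : HeckeCharacter K)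
    (S : Finset (HeightOneSpectrum (𝓞 K))) (hur : ∀ v ∉ S, χ.IsUnramifiedAt v) :
    ∃ 𝔫 : Ideal (𝓞 K), 𝔫 ≠ 0 ∧ (∀ w : HeightOneSpectrum (𝓞 K), w.asIdeal ∣ 𝔫 → w ∈ S) ∧
      ∀ k ∈ principalCongruenceLevel n K 𝔫, χ (Matrix.GeneralLinearGroup.det k) = 1 := by
  classical
  obtain ⟨𝔫₀, h𝔫₀, h0⟩ := χ.exists_level n
  -- peel off, one at a time, the primes of a finite set `F` disjoint from `S`
  have key : ∀ F : Finset (HeightOneSpectrum (𝓞 K)), (∀ v ∈ F, v ∉ S) →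
      ∃ 𝔫 : Ideal (𝓞 K), 𝔫 ≠ 0 ∧ (∀ v ∈ F, ¬ v.asIdeal ∣ 𝔫) ∧
        (∀ w : HeightOneSpectrum (𝓞 K), w.asIdeal ∣ 𝔫 → w.asIdeal ∣ 𝔫₀) ∧
        ∀ k ∈ principalCongruenceLevel n K 𝔫, χ (Matrix.GeneralLinearGroup.det k) = 1 := by
    intro F
    refine Finset.induction_on F (fun _ => ⟨𝔫₀, h𝔫₀, fun v hv => absurd hv (Finset.notMem_empty v),
      fun w hw => hw, h0⟩) ?_
    intro v F hvF ih hF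
    obtain ⟨𝔫, h𝔫, hF𝔫, hdiv, hχ𝔫⟩ := ih fun u hu => hF u (Finset.mem_insert_of_mem hu)
    obtain ⟨𝔫', h𝔫', hv𝔫', hdiv', hχ𝔫'⟩ :=
      χ.exists_level_peel n h𝔫 hχ𝔫 (hur v (hF v (Finset.mem_insert_self v F)))
    refine ⟨𝔫', h𝔫', fun u hu => ?_, fun w hw => hdiv w (hdiv' w hw), hχ𝔫'⟩
    rcases Finset.mem_insert.mp hu with rfl | hu
    · exact hv𝔫'
    · exact fun h => hF𝔫 u hu (hdiv' u h)
  obtain ⟨𝔫, h𝔫, hF, hdiv, hχ𝔫⟩ :=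
    key ((primesOf h𝔫₀).filter fun v => v ∉ S) fun v hv => (Finset.mem_filter.mp hv).2
  refine ⟨𝔫, h𝔫, fun w hw => ?_, hχ𝔫⟩
  by_contra hwS
  exact hF w (Finset.mem_filter.mpr ⟨(mem_primesOf_iff h𝔫₀).mpr (hdiv w hw), hwS⟩) hw

end Literature.NumberTheory.GaloisRepresentations.HeckeCharacter

namespace Literature.NumberTheory.Automorphic

/-! ### `GL_1`: the Hecke character governs the regular representation on `Π` -/

section GLOne

variable {K : Type} [Field K] [NumberField K]
  {μ : Measure (AdelicGroupData.gl 1 K).automorphicQuotient} [(AdelicGroupData.gl 1 K).IsAutomorphicMeasure μ]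

namespace CuspidalAutomorphicRepGL

/-- `R(g) φ = χ_Π(det g) φ` for `φ ∈ Π ≤ L²_cusp(GL_1)` (`GL_1`: `g` is the scalar matrix of
`det g`). [folklore] -/
theorem rightRegular_apply_eq_heckeCharacter_det_smul (P : CuspidalAutomorphicRepGL 1 K μ)
    (g : (AdelicGroupData.gl 1 K).Adelic) {φ : (AdelicGroupData.gl 1 K).L2 μ} (hφ : φ ∈ P.1) :
    (AdelicGroupData.gl 1 K).rightRegular μ g φ =
      ((P.heckeCharacter (Matrix.GeneralLinearGroup.det g) : ℂˣ) : ℂ) • φ := by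
  rw [GLOne.rightRegular_apply_eq_eigenvalue_smul P.isTopIrreducible g hφ,
    GLOne.eigenvalue_eq_heckeCharacter_det]
  rfl

/-- `χ_Π(det k) = 1` forces `R(k) φ = φ` on `Π`. [folklore] -/
theorem rightRegular_apply_eq_self_of_heckeCharacter_det (P : CuspidalAutomorphicRepGL 1 K μ)
    {k : (AdelicGroupData.gl 1 K).Adelic} (hk : P.heckeCharacter (Matrix.GeneralLinearGroup.det k) = 1)
    {φ : (AdelicGroupData.gl 1 K).L2 μ} (hφ : φ ∈ P.1) :
    (AdelicGroupData.gl 1 K).rightRegular μ k φ = φ := by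
  rw [P.rightRegular_apply_eq_heckeCharacter_det_smul k hφ, hk, Units.val_one, one_smul]

/-- **Local units at unramified places act trivially**: if `χ_Π` is unramified at `v` then
`R(ι_v(x)) φ = φ` for every `x ∈ GL_1(𝒪_v)` and `φ ∈ Π` (`det ι_v(x) = ⟨det x⟩_v` with
`det x ∈ 𝒪_vˣ`). [folklore] -/
theorem rightRegular_ofLocal_apply_eq_self (P : CuspidalAutomorphicRepGL 1 K μ)
    {v : HeightOneSpectrum (𝓞 K)} (hv : P.heckeCharacter.IsUnramifiedAt v)
    {x : GL (Fin 1) (v.adicCompletion K)}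
    (hx : x ∈ valuedCongruenceSubgroup (Fin 1) (1 : WithZero (Multiplicative ℤ)))
    {φ : (AdelicGroupData.gl 1 K).L2 μ} (hφ : φ ∈ P.1) :
    (AdelicGroupData.gl 1 K).rightRegular μ (GLn.ofLocal 1 K v x) φ = φ := by
  refine P.rightRegular_apply_eq_self_of_heckeCharacter_det ?_ hφ
  rw [GLn.det_ofLocal]
  exact hv.map_localUnits_eq_one _ (valued_det_eq_one_of_mem_valuedCongruenceSubgroup hx)

/-- **`Π` is spherical off the ramification of `χ_Π`**: if `χ_Π` is unramified at every `v ∉ S`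
then every `φ ∈ Π` is fixed by the away-from-`S` level `K^S = ∏_{w ∉ S} GL_1(𝒪_w)`
(`exists_level_subset_of_isUnramifiedAt`: a level `K(𝔫) ≥ K^S` with the primes of `𝔫` in `S`).
[folklore] -/
theorem rightRegular_apply_eq_self_of_mem_awayLevel (P : CuspidalAutomorphicRepGL 1 K μ)
    (S : Finset (HeightOneSpectrum (𝓞 K))) (hur : ∀ v ∉ S, P.heckeCharacter.IsUnramifiedAt v)
    {φ : (AdelicGroupData.gl 1 K).L2 μ} (hφ : φ ∈ P.1) :
    ∀ k ∈ awayLevel K 1 S, (AdelicGroupData.gl 1 K).rightRegular μ k φ = φ := by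
  obtain ⟨𝔫, h𝔫, hS, hχ⟩ := P.heckeCharacter.exists_level_subset_of_isUnramifiedAt 1 S hur
  intro k hk
  exact P.rightRegular_apply_eq_self_of_heckeCharacter_det
    (hχ k (awayLevel_le_principalCongruenceLevel h𝔫 hS hk)) hφ

attribute [local instance] adelicBorel borelSpace_adelic locallyCompactSpace_adelic
  secondCountableTopology_gl_adelic measurableSpaceQuotient borelSpaceQuotient
  smulInvariantMeasureQuotient isFiniteMeasureOnCompactsQuotient

/-- **Non-trivial characters integrate to zero**: for `φ ∈ Π ≤ L²_cusp(GL_1)` with `χ_Π ≠ 1`,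
`∫_X φ dμ = 0` — pick an idele `a` with `χ_Π(a) ≠ 1`; by invariance of `μ`,
`∫ φ = ∫ R(a) φ = χ_Π(a) ∫ φ` (Tate (1967), Lemma B: orthogonality of a non-trivial character).
[cite: TateThesis1967, Thm. 4.4.1 (Lemma B)] -/
theorem integral_eq_zero_of_heckeCharacter_ne_one (P : CuspidalAutomorphicRepGL 1 K μ)
    (hP : P.heckeCharacter ≠ 1) {φ : (AdelicGroupData.gl 1 K).L2 μ} (hφ : φ ∈ P.1) :
    ∫ x, (φ : (AdelicGroupData.gl 1 K).automorphicQuotient → ℂ) x ∂μ = 0 := by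
  obtain ⟨a, ha⟩ : ∃ a : (AdeleRing (𝓞 K) K)ˣ, P.heckeCharacter a ≠ 1 := by
    by_contra h
    exact hP (GaloisRepresentations.HeckeCharacter.ext fun a => by
      rw [GaloisRepresentations.HeckeCharacter.one_apply]
      exact not_not.mp (not_exists.mp h a))
  have ha' : ((P.heckeCharacter a : ℂˣ) : ℂ) ≠ 1 := fun h => ha (Units.val_eq_one.mp h)
  set g : (AdelicGroupData.gl 1 K).Adelic := Matrix.GeneralLinearGroup.scalar (Fin 1) a with hg
  have hdet : Matrix.GeneralLinearGroup.det g = a := by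
    refine Units.ext ?_
    rw [hg, Matrix.GeneralLinearGroup.val_det_apply, Matrix.GeneralLinearGroup.coe_scalar,
      Matrix.det_fin_one, Matrix.scalar_apply, Matrix.diagonal_apply_eq]
  have hR : (AdelicGroupData.gl 1 K).rightRegular μ g φ = ((P.heckeCharacter a : ℂˣ) : ℂ) • φ := by
    rw [P.rightRegular_apply_eq_heckeCharacter_det_smul g hφ, hdet]
  -- `∫ R(g) φ = ∫ φ` by invariance, `= χ(a) ∫ φ` by the eigen-equation
  have hinv : ∫ x, ((AdelicGroupData.gl 1 K).rightRegular μ g φ :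
      (AdelicGroupData.gl 1 K).automorphicQuotient → ℂ) x ∂μ =
      ∫ x, (φ : (AdelicGroupData.gl 1 K).automorphicQuotient → ℂ) x ∂μ := by
    rw [integral_congr_ae ((AdelicGroupData.gl 1 K).rightRegular_apply_coeFn μ g φ)]
    exact integral_smul_eq_self (μ := μ) (fun x => (φ : (AdelicGroupData.gl 1 K).automorphicQuotient → ℂ) x)
  have hsm : ∫ x, ((AdelicGroupData.gl 1 K).rightRegular μ g φ :
      (AdelicGroupData.gl 1 K).automorphicQuotient → ℂ) x ∂μ =
      ((P.heckeCharacter a : ℂˣ) : ℂ) * ∫ x, (φ : (AdelicGroupData.gl 1 K).automorphicQuotient → ℂ) x ∂μ := by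
    rw [hR, integral_congr_ae (Lp.coeFn_smul _ _)]
    simp only [Pi.smul_apply, smul_eq_mul]
    exact integral_const_mul _ _
  have h1 : (((P.heckeCharacter a : ℂˣ) : ℂ) - 1) *
      ∫ x, (φ : (AdelicGroupData.gl 1 K).automorphicQuotient → ℂ) x ∂μ = 0 := by
    rw [sub_mul, one_mul, ← hsm, hinv, sub_self]
  exact (mul_eq_zero.mp h1).resolve_left (sub_ne_zero.mpr ha')

end CuspidalAutomorphicRepGL

end GLOne


/-! ### Unfolding data adapted to a point `s₀`, with level supported on `S` -/

section AdaptedData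

variable {n : ℕ} {K : Type} [Field K] [NumberField K]

/-- The primes of `𝔫 · ∏_{w ∈ S} 𝔭_w` are exactly `S` when those of `𝔫` lie in `S`. [folklore] -/
theorem exists_primesOf_mul_prod_eq {𝔫 : Ideal (𝓞 K)} (h𝔫 : 𝔫 ≠ 0) (S : Finset (HeightOneSpectrum (𝓞 K)))
    (hS : ∀ w : HeightOneSpectrum (𝓞 K), w.asIdeal ∣ 𝔫 → w ∈ S) :
    ∃ h : 𝔫 * ∏ w ∈ S, w.asIdeal ≠ 0, primesOf h = S ∧ 𝔫 * ∏ w ∈ S, w.asIdeal ≤ 𝔫 := by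
  have hP : ∏ w ∈ S, w.asIdeal ≠ 0 := Finset.prod_ne_zero_iff.2 fun w _ => w.ne_bot
  have h : 𝔫 * ∏ w ∈ S, w.asIdeal ≠ 0 := mul_ne_zero h𝔫 hP
  refine ⟨h, Finset.ext fun w => ?_, Ideal.mul_le_right⟩
  rw [mem_primesOf_iff]
  constructor
  · intro hw
    rcases (w.isPrime.mul_le).mp (Ideal.le_of_dvd hw) with h1 | h1
    · exact hS w (Ideal.dvd_iff_le.mpr h1)
    · exact (prod_asIdeal_le_iff S w).mp h1
  · intro hw
    exact Ideal.dvd_iff_le.mpr (Ideal.mul_le_left.trans ((prod_asIdeal_le_iff S w).mpr hw))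

/-- `|det ι_v(x)|_𝔸 = 1` for `x ∈ GL_n(𝒪_v)`. [folklore] -/
theorem adelicAbsDet_ofLocal_eq_one_of_mem {v : HeightOneSpectrum (𝓞 K)} {x : GL (Fin n) (v.adicCompletion K)}
    (hx : x ∈ valuedCongruenceSubgroup (Fin n) (1 : WithZero (Multiplicative ℤ))) :
    adelicAbsDet n K (GLn.ofLocal n K v x) = 1 := by
  rw [adelicAbsDet_ofLocal]
  have h : ‖(x : Matrix (Fin n) (Fin n) (v.adicCompletion K)).det‖ = 1 :=
    norm_det_eq_one_of_mem_glInt (by rw [glInt_adicCompletion_eq]; exact hx)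
  exact NNReal.eq (by rw [coe_nnnorm, h, NNReal.coe_one])

/-- `ι_v(GL_n(𝒪_v)) ≤ K^S` for `v ∉ S`. [folklore] -/
theorem ofLocal_mem_awayLevel_of_mem {S : Finset (HeightOneSpectrum (𝓞 K))} {v : HeightOneSpectrum (𝓞 K)}
    (hv : v ∉ S) {x : GL (Fin n) (v.adicCompletion K)}
    (hx : x ∈ valuedCongruenceSubgroup (Fin n) (1 : WithZero (Multiplicative ℤ))) :
    GLn.ofLocal n K v x ∈ awayLevel K n S := by
  have h := ofLocalAway_mem_awayLevelIn (T := S) hv (g := x) (by rw [glInt_adicCompletion_eq]; exact hx)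
  exact Subgroup.mem_subgroupOf.mp h

variable {μ : Measure (AdelicGroupData.gl n K).automorphicQuotient} [(AdelicGroupData.gl n K).IsAutomorphicMeasure μ]

/-- **The data of the unfolding, adapted to a point `s₀` and with level supported on `S`.** Let
`0 ≠ φ ∈ L²` be fixed by `ι_v(GL_n(𝒪_v))` for every finite `v ∉ S`. For every `s₀ ∈ ℂ` there are
a level `𝔫 ≠ 0` whose primes are **exactly** `S`, an archimedean bump `Φ_∞` (values in `[0,1]`,
`Φ_∞(1) = 1`) and a compact `N ⊆ GL_n(𝔸_K)` such that the `G_S`-part `Φ_G` of the test function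
`Φ_∞ ⊗ 1_{B(𝔫)}` vanishes at every `a ∈ G_S` outside `N` or with
`|⟪φ, R(a) φ⟫ |det a|_𝔸^{s₀} - ⟪φ, φ⟫| ≥ ‖φ‖²/2` (`exists_isOpen_level_subset_of_invariant`
applied to the neighbourhood `N ∩ {…}` of `1`, which is invariant under the `ι_v(GL_n(𝒪_v))`,
`v ∉ S`, because they fix `φ` and have `|det| = 1`; then the level is multiplied by `∏_{w ∈ S} 𝔭_w`).
The variant of `exists_unfolding_data` (there: `s₀` real, arbitrary primes). [folklore] -/
theorem exists_unfolding_data_at (S : Finset (HeightOneSpectrum (𝓞 K)))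
    {φ : (AdelicGroupData.gl n K).L2 μ} (hφ0 : φ ≠ 0)
    (hfix : ∀ v ∉ S, ∀ x ∈ valuedCongruenceSubgroup (Fin n) (1 : WithZero (Multiplicative ℤ)),
      (AdelicGroupData.gl n K).rightRegular μ (GLn.ofLocal n K v x) φ = φ)
    (s₀ : ℂ) :
    ∃ (𝔫 : Ideal (𝓞 K)) (h𝔫 : 𝔫 ≠ 0) (Φinf : SchwartzMap (Fin n → Fin n → mixedSpace K) ℂ)
      (N : Set (GL (Fin n) (AdeleRing (𝓞 K) K))),
      primesOf h𝔫 = S ∧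
      (∀ x, ∃ r : ℝ, 0 ≤ r ∧ r ≤ 1 ∧ Φinf x = r) ∧ Φinf (1 : Matrix (Fin n) (Fin n) (mixedSpace K)) = 1 ∧
      IsCompact N ∧
      ∀ a : placesFactor K n (primesOf h𝔫), gjTestFunctionG n K Φinf 𝔫 (a : GL (Fin n) (AdeleRing (𝓞 K) K)) ≠ 0 →
        (a : GL (Fin n) (AdeleRing (𝓞 K) K)) ∈ N ∧
          ‖glMatrixCoeff μ φ φ (a : GL (Fin n) (AdeleRing (𝓞 K) K)) *
              ((adelicAbsDet n K (a : GL (Fin n) (AdeleRing (𝓞 K) K)) : ℝ) : ℂ) ^ s₀ - ⟪φ, φ⟫_ℂ‖ <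
            ‖φ‖ ^ 2 / 2 := by
  haveI : LocallyCompactSpace (GL (Fin n) (AdeleRing (𝓞 K) K)) :=
    AdelicGroupData.locallyCompactSpace_gl_adelic_holds n K
  -- a compact neighbourhood of `1`, saturated by `K^S`
  obtain ⟨N₀, hN₀, hN₀1⟩ := exists_compact_mem_nhds (1 : GL (Fin n) (AdeleRing (𝓞 K) K))
  set N : Set (GL (Fin n) (AdeleRing (𝓞 K) K)) := N₀ * (awayLevel K n S : Set (GL (Fin n) (AdeleRing (𝓞 K) K)))
    with hNdef
  have hN : IsCompact N := hN₀.mul (isCompact_awayLevel n S)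
  have hN1 : N ∈ 𝓝 (1 : GL (Fin n) (AdeleRing (𝓞 K) K)) :=
    Filter.mem_of_superset hN₀1 fun x hx => ⟨x, hx, 1, (awayLevel K n S).one_mem, mul_one x⟩
  -- the neighbourhood where the weighted coefficient is close to `⟪φ, φ⟫`
  set U₁ : Set (GL (Fin n) (AdeleRing (𝓞 K) K)) := {g | ‖glMatrixCoeff μ φ φ g *
      ((adelicAbsDet n K g : ℝ) : ℂ) ^ s₀ - ⟪φ, φ⟫_ℂ‖ < ‖φ‖ ^ 2 / 2} with hU₁def
  have hU₁ : U₁ ∈ 𝓝 (1 : GL (Fin n) (AdeleRing (𝓞 K) K)) := by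
    have hc : Continuous fun g : GL (Fin n) (AdeleRing (𝓞 K) K) =>
        ‖glMatrixCoeff μ φ φ g * ((adelicAbsDet n K g : ℝ) : ℂ) ^ s₀ - ⟪φ, φ⟫_ℂ‖ :=
      (((continuous_glMatrixCoeff φ φ).mul (continuous_adelicAbsDet_cpow s₀)).sub continuous_const).norm
    refine (isOpen_lt hc continuous_const).mem_nhds ?_
    show ‖glMatrixCoeff μ φ φ 1 * ((adelicAbsDet n K 1 : ℝ) : ℂ) ^ s₀ - ⟪φ, φ⟫_ℂ‖ < ‖φ‖ ^ 2 / 2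
    rw [glMatrixCoeff_one, map_one, NNReal.coe_one, Complex.ofReal_one, Complex.one_cpow, mul_one, sub_self,
      norm_zero]
    exact half_pos (pow_pos (norm_pos_iff.2 hφ0) 2)
  -- invariance of `N ∩ U₁` under `ι_v(GL_n(𝒪_v))`, `v ∉ S`
  have hinv : ∀ v ∉ S, ∀ x ∈ valuedCongruenceSubgroup (Fin n) (1 : WithZero (Multiplicative ℤ)),
      ∀ g ∈ N ∩ U₁, g * GLn.ofLocal n K v x ∈ N ∩ U₁ := by
    intro v hv x hx g hg
    obtain ⟨⟨n₀, hn₀, k, hk, rfl⟩, hgU⟩ := hg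
    refine ⟨⟨n₀, hn₀, k * GLn.ofLocal n K v x, (awayLevel K n S).mul_mem hk (ofLocal_mem_awayLevel_of_mem hv hx),
      (mul_assoc _ _ _).symm⟩, ?_⟩
    show ‖glMatrixCoeff μ φ φ (n₀ * k * GLn.ofLocal n K v x) *
        ((adelicAbsDet n K (n₀ * k * GLn.ofLocal n K v x) : ℝ) : ℂ) ^ s₀ - ⟪φ, φ⟫_ℂ‖ < ‖φ‖ ^ 2 / 2
    rw [glMatrixCoeff_apply, rightRegular_mul_apply, hfix v hv x hx, map_mul, adelicAbsDet_ofLocal_eq_one_of_mem hx,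
      mul_one, ← glMatrixCoeff_apply]
    exact hgU
  obtain ⟨V, hV, h1V, 𝔫₂, h𝔫₂, hS₂, hVU⟩ := exists_isOpen_level_subset_of_invariant S (Filter.inter_mem hN1 hU₁) hinv
  obtain ⟨Φinf, hΦ01, hΦ1, hΦV⟩ := exists_schwartz_bump_mixedSpace hV h1V
  obtain ⟨h𝔫, hT, hle⟩ := exists_primesOf_mul_prod_eq h𝔫₂ S hS₂
  refine ⟨_, h𝔫, Φinf, N, hT, hΦ01, hΦ1, hN, fun a ha => ?_⟩
  obtain ⟨haV, haK⟩ := gjTestFunctionG_ne_zero_imp hΦV h𝔫 a ha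
  exact hVU _ haV (principalCongruenceLevel_mono n K h𝔫 hle haK)

variable {T : Finset (HeightOneSpectrum (𝓞 K))}
  [MeasurableSpace (placesFactor K n T)] [BorelSpace (placesFactor K n T)]
  (μG : Measure (placesFactor K n T)) [μG.IsHaarMeasure]

/-- **The local zeta integral does not vanish at `s₀` for data adapted to `s₀`.** If `Ψ` is
continuous with values in `[0, 1]`, `Ψ(1) = 1`, `φ ≠ 0`, and `Ψ` is supported in a compact set on
which `|⟪φ, R(a) φ⟫ |det a|_𝔸^{s₀} - ⟪φ, φ⟫| < ‖φ‖²/2`, then `Re Z_T(s₀) > 0`: the real part of the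
integrand is the continuous compactly supported function `Ψ(a) Re(⟪φ, R(a) φ⟫ |det a|^{s₀}) ≥ 0`,
positive at `a = 1`, and Haar measure charges opens (the variant of `re_placesZeta_pos` at a complex
point). [folklore] -/
theorem re_placesZeta_pos_at {Ψ : GL (Fin n) (AdeleRing (𝓞 K) K) → ℂ} (hΨc : Continuous Ψ)
    (hΨ01 : ∀ a, ∃ r : ℝ, 0 ≤ r ∧ r ≤ 1 ∧ Ψ a = r) (hΨ1 : Ψ 1 = 1)
    {N : Set (GL (Fin n) (AdeleRing (𝓞 K) K))} (hN : IsCompact N) {φ : (AdelicGroupData.gl n K).L2 μ} (hφ0 : φ ≠ 0)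
    (s₀ : ℂ)
    (hsupp : ∀ a : placesFactor K n T, Ψ a ≠ 0 → (a : GL (Fin n) (AdeleRing (𝓞 K) K)) ∈ N ∧
      ‖glMatrixCoeff μ φ φ (a : GL (Fin n) (AdeleRing (𝓞 K) K)) *
          ((adelicAbsDet n K (a : GL (Fin n) (AdeleRing (𝓞 K) K)) : ℝ) : ℂ) ^ s₀ - ⟪φ, φ⟫_ℂ‖ < ‖φ‖ ^ 2 / 2) :
    0 < (placesZeta T μG Ψ φ s₀).re := by
  set d : placesFactor K n T → ℝ := fun a => (adelicAbsDet n K (a : GL (Fin n) (AdeleRing (𝓞 K) K)) : ℝ) with hd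
  have hd0 : ∀ a, 0 < d a := fun a => adelicAbsDet_pos _
  -- the weighted coefficient
  set c : placesFactor K n T → ℂ := fun a =>
    glMatrixCoeff μ φ φ (a : GL (Fin n) (AdeleRing (𝓞 K) K)) * (((d a : ℝ) : ℂ)) ^ s₀ with hc
  have hcc : Continuous c :=
    ((continuous_glMatrixCoeff φ φ).comp continuous_subtype_val).mul
      ((continuous_adelicAbsDet_cpow s₀).comp continuous_subtype_val)
  -- the real part of the integrand
  choose r hr0 hr1 hr using hΨ01
  set g : placesFactor K n T → ℝ := fun a => r (a : GL (Fin n) (AdeleRing (𝓞 K) K)) * (c a).re with hg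
  have hre : ∀ a : placesFactor K n T, (Ψ (a : GL (Fin n) (AdeleRing (𝓞 K) K)) *
      glMatrixCoeff μ φ φ (a : GL (Fin n) (AdeleRing (𝓞 K) K)) * (((d a : ℝ) : ℂ)) ^ s₀).re = g a := by
    intro a
    rw [hr, mul_assoc, Complex.re_ofReal_mul]
  have hint : Integrable (fun a : placesFactor K n T => Ψ (a : GL (Fin n) (AdeleRing (𝓞 K) K)) *
      glMatrixCoeff μ φ φ (a : GL (Fin n) (AdeleRing (𝓞 K) K)) * (((d a : ℝ) : ℂ)) ^ s₀) μG := by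
    refine (continuous_placesZeta_integrand hΨc φ s₀).integrable_of_hasCompactSupport ?_
    refine hasCompactSupport_placesFactor hN fun a ha => (hsupp a fun h => ha ?_).1
    rw [h, zero_mul, zero_mul]
  have hZ : (placesZeta T μG Ψ φ s₀).re = ∫ a, g a ∂μG := by
    rw [placesZeta, ← RCLike.re_eq_complex_re, ← integral_re hint]
    exact integral_congr_ae (Filter.Eventually.of_forall fun a => by rw [RCLike.re_eq_complex_re]; exact hre a)
  rw [hZ]
  -- lower bound for the weighted coefficient on the support
  have hφ : 0 < ‖φ‖ := norm_pos_iff.2 hφ0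
  have e3 : (⟪φ, φ⟫_ℂ).re = ‖φ‖ ^ 2 := by
    have := inner_self_eq_norm_sq (𝕜 := ℂ) φ
    simpa using this
  have hcoeff : ∀ a : placesFactor K n T, Ψ a ≠ 0 → ‖φ‖ ^ 2 / 2 < (c a).re := by
    intro a ha
    have h := (hsupp a ha).2
    have h1 : (⟪φ, φ⟫_ℂ - c a).re ≤ ‖c a - ⟪φ, φ⟫_ℂ‖ :=
      (Complex.re_le_norm _).trans (by rw [norm_sub_rev])
    rw [Complex.sub_re, e3] at h1
    linarith
  have hg0 : 0 ≤ g := by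
    intro a
    simp only [hg, Pi.zero_apply]
    by_cases ha : Ψ (a : GL (Fin n) (AdeleRing (𝓞 K) K)) = 0
    · have : r (a : GL (Fin n) (AdeleRing (𝓞 K) K)) = 0 := by
        have h := hr (a : GL (Fin n) (AdeleRing (𝓞 K) K)); rw [ha] at h; exact_mod_cast h.symm
      rw [this, zero_mul]
    · exact mul_nonneg (hr0 _) ((div_pos (pow_pos hφ 2) two_pos).trans (hcoeff a ha)).le
  have hgc : Continuous g := by
    have h1 : Continuous fun a : placesFactor K n T => (r (a : GL (Fin n) (AdeleRing (𝓞 K) K)) : ℂ) := by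
      have e : (fun a : placesFactor K n T => (r (a : GL (Fin n) (AdeleRing (𝓞 K) K)) : ℂ)) =
          fun a : placesFactor K n T => Ψ (a : GL (Fin n) (AdeleRing (𝓞 K) K)) := funext fun a => (hr _).symm
      rw [e]; exact hΨc.comp continuous_subtype_val
    have h1' : Continuous fun a : placesFactor K n T => r (a : GL (Fin n) (AdeleRing (𝓞 K) K)) := by
      have h2 : Continuous fun a : placesFactor K n T => ((r (a : GL (Fin n) (AdeleRing (𝓞 K) K)) : ℝ) : ℂ).re :=
        Complex.continuous_re.comp h1
      simpa only [Complex.ofReal_re] using h2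
    exact h1'.mul (Complex.continuous_re.comp hcc)
  have hgs : HasCompactSupport g := by
    refine hasCompactSupport_placesFactor hN fun a ha => (hsupp a fun h => ha ?_).1
    have : r (a : GL (Fin n) (AdeleRing (𝓞 K) K)) = 0 := by
      have h' := hr (a : GL (Fin n) (AdeleRing (𝓞 K) K)); rw [h] at h'; exact_mod_cast h'.symm
    simp only [hg, this, zero_mul]
  have hg1 : g 1 ≠ 0 := by
    have hr1' : r (1 : GL (Fin n) (AdeleRing (𝓞 K) K)) = 1 := by
      have h := hr (1 : GL (Fin n) (AdeleRing (𝓞 K) K))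
      rw [hΨ1] at h; exact_mod_cast h.symm
    have hΨ1' : Ψ ((1 : placesFactor K n T) : GL (Fin n) (AdeleRing (𝓞 K) K)) ≠ 0 := by
      rw [OneMemClass.coe_one, hΨ1]; exact one_ne_zero
    have h2 := hcoeff 1 hΨ1'
    simp only [hg, OneMemClass.coe_one, hr1', one_mul]
    have h3 : 0 < ‖φ‖ ^ 2 / 2 := div_pos (pow_pos hφ 2) two_pos
    exact (h3.trans h2).ne'
  exact hgc.integral_pos_of_hasCompactSupport_nonneg_nonzero hgs hg0 hg1

end AdaptedData


/-! ### Rank one: the zeta quotient at a point, and the entire continuation of `L^S(s, Π)` -/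

section RankOneEntire

variable {K : Type} [Field K] [NumberField K]
  {μ : Measure (AdelicGroupData.gl 1 K).automorphicQuotient} [(AdelicGroupData.gl 1 K).IsAutomorphicMeasure μ]

attribute [local instance] adelicBorel borelSpace_adelic locallyCompactSpace_adelic
  secondCountableTopology_gl_adelic measurableSpaceQuotient borelSpaceQuotient glBorel borelSpace_glBorel
  isHaarMeasure_glForm smulInvariantMeasureQuotient isFiniteMeasureOnCompactsQuotient
  secondCountableTopology_adeleRing locallyCompactSpace_adeleRing'

/-- **The zeta-quotient representation of `L^T(s, Π)` at a prescribed point** (`Π` cuspidal of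
`GL_1(𝔸_K)`, `T = T(𝔫)` the primes of a level `𝔫`). Given `0 ≠ φ ∈ Π` fixed by `K^T` with
`∫_X φ = 0`, an honest Satake family `γ` of `Π` off `T`, and a bump `Φ_∞` and compact `N` adapted to
`s₀` (`exists_unfolding_data_at`), there are ENTIRE `Z`, `A` with `A(s₀) ≠ 0` and
`Z(s) = A(s) · L^T(s, γ)` for `Re s > 4`: `Z` is the entire continuation of the zeta integral
`Z(Φ_∞ ⊗ 1_{B(𝔫)}, s, φ, φ)` (`gjZeta_entire_continuation_fin_one_of_integral_mul_eq_zero`), the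
factorisation is the `K^T`-spherical unfolding `gjZeta_awayProductMeasure_eq` (Godement–Jacquet,
proof of Thm. 13.8; for `GL_1`: Tate (1967), §4.5, `ζ(f, c) = ∏_{𝔭 ∈ S} ζ_𝔭 · ∏_{𝔭 ∉ S} … · ζ(s, χ)`),
and `A = vol(K^T) · Z_T` with `Z_T` entire (`differentiable_placesZeta`) and `Re Z_T(s₀) > 0`
(`re_placesZeta_pos_at`). [cite: TateThesis1967, Thm. 4.4.1 and §4.5] [cite: GodementJacquet1972, Thm. 13.8 (proof)] -/
theorem exists_entire_eq_mul_partialStandardL_fin_one (P : CuspidalAutomorphicRepGL 1 K μ)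
    {𝔫 : Ideal (𝓞 K)} (h𝔫 : 𝔫 ≠ 0) {γ : SatakeFamily K}
    (hγ : IsSatakeFamilyOf P (↑(primesOf h𝔫) : Set (HeightOneSpectrum (𝓞 K))) γ)
    {φ : (AdelicGroupData.gl 1 K).L2 μ} (hφP : φ ∈ P.1) (hφ0 : φ ≠ 0)
    (hφT : ∀ k ∈ awayLevel K 1 (primesOf h𝔫), (AdelicGroupData.gl 1 K).rightRegular μ k φ = φ)
    (h0 : ∫ x, (φ : (AdelicGroupData.gl 1 K).automorphicQuotient → ℂ) x ∂μ = 0)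
    {Φinf : SchwartzMap (Fin 1 → Fin 1 → mixedSpace K) ℂ}
    (hΦ01 : ∀ x, ∃ r : ℝ, 0 ≤ r ∧ r ≤ 1 ∧ Φinf x = r) (hΦ1 : Φinf (1 : Matrix (Fin 1) (Fin 1) (mixedSpace K)) = 1)
    {N : Set (GL (Fin 1) (AdeleRing (𝓞 K) K))} (hN : IsCompact N) (s₀ : ℂ)
    (hsupp : ∀ a : placesFactor K 1 (primesOf h𝔫),
      gjTestFunctionG 1 K Φinf 𝔫 (a : GL (Fin 1) (AdeleRing (𝓞 K) K)) ≠ 0 →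
        (a : GL (Fin 1) (AdeleRing (𝓞 K) K)) ∈ N ∧
          ‖glMatrixCoeff μ φ φ (a : GL (Fin 1) (AdeleRing (𝓞 K) K)) *
              ((adelicAbsDet 1 K (a : GL (Fin 1) (AdeleRing (𝓞 K) K)) : ℝ) : ℂ) ^ s₀ - ⟪φ, φ⟫_ℂ‖ <
            ‖φ‖ ^ 2 / 2) :
    ∃ Z A : ℂ → ℂ, Differentiable ℂ Z ∧ Differentiable ℂ A ∧ A s₀ ≠ 0 ∧
      ∀ s : ℂ, (4 : ℝ) < s.re →
        Z s = A s * partialStandardL (↑(primesOf h𝔫) : Set (HeightOneSpectrum (𝓞 K))) γ s := by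
  set T : Finset (HeightOneSpectrum (𝓞 K)) := primesOf h𝔫 with hTdef
  haveI : LocallyCompactSpace (GL (Fin 1) (AdeleRing (𝓞 K) K)) :=
    AdelicGroupData.locallyCompactSpace_gl_adelic_holds 1 K
  haveI : SecondCountableTopology (GL (Fin 1) (AdeleRing (𝓞 K) K)) :=
    secondCountableTopology_generalLinearGroup_adeleRing K (Fin 1)
  -- the test function and its `G_T`-part
  set Φ := gjTestFunction 1 K Φinf 𝔫 with hΦdef
  set Ψ : GL (Fin 1) (AdeleRing (𝓞 K) K) → ℂ := gjTestFunctionG 1 K Φinf 𝔫 with hΨdef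
  have hΨc : Continuous Ψ := continuous_gjTestFunctionG Φinf h𝔫
  have hΨN : ∀ a : placesFactor K 1 T, Ψ a ≠ 0 → (a : GL (Fin 1) (AdeleRing (𝓞 K) K)) ∈ N :=
    fun a ha => (hsupp a ha).1
  -- Haar measures on the factors and the product Haar measure on `GL_1(𝔸_K)`
  letI : MeasurableSpace (awayFactor K 1 T) := borel _
  haveI : BorelSpace (awayFactor K 1 T) := ⟨rfl⟩
  letI : MeasurableSpace (placesFactor K 1 T) := borel _
  haveI : BorelSpace (placesFactor K 1 T) := ⟨rfl⟩
  haveI := locallyCompactSpace_awayFactor K 1 T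
  haveI := locallyCompactSpace_placesFactor K 1 T
  set μH : Measure (awayFactor K 1 T) := Measure.haar with hμH
  set μG : Measure (placesFactor K 1 T) := Measure.haar with hμG
  set m : Measure (GL (Fin 1) (AdeleRing (𝓞 K) K)) := awayProductMeasure K 1 T μH μG with hm
  haveI hmH : m.IsHaarMeasure := isHaarMeasure_awayProductMeasure μH μG
  -- the same measure on the house spelling `(gl 1 K).Adelic` of `GL_1(𝔸_K)`
  haveI hmA : @Measure.IsHaarMeasure (AdelicGroupData.gl 1 K).Adelic _ _ (adelicBorel 1 K) m := hmH
  -- `Z`: the entire continuation of the zeta integral for `m` (polar coefficient zero)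
  have h00 : (∫ x, conj ((φ : (AdelicGroupData.gl 1 K).automorphicQuotient → ℂ) x) ∂μ) *
      (∫ x, (φ : (AdelicGroupData.gl 1 K).automorphicQuotient → ℂ) x ∂μ) = 0 := by
    rw [h0, mul_zero]
  obtain ⟨-, Z, hZ, hZeq⟩ := gjZeta_entire_continuation_fin_one_of_integral_mul_eq_zero μ
    (gjTestFunction_mem Φinf h𝔫) φ φ h00 (m : Measure (AdelicGroupData.gl 1 K).Adelic)
  -- `A = vol(K^T) · Z_T`
  have hvol0 : 0 < (μH (awayLevelIn K 1 T)).toReal :=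
    ENNReal.toReal_pos ((isOpen_awayLevelIn K 1 T).measure_pos μH ⟨1, one_mem _⟩).ne'
      (measure_awayLevelIn_lt_top μH).ne
  set A : ℂ → ℂ := fun s => ((μH (awayLevelIn K 1 T)).toReal : ℂ) * placesZeta T μG Ψ φ s with hA
  have hAd : Differentiable ℂ A := (differentiable_placesZeta μG hΨc hN hΨN φ).const_mul _
  have hA0 : A s₀ ≠ 0 := by
    refine mul_ne_zero (Complex.ofReal_ne_zero.2 hvol0.ne') fun h => ?_
    have hpos := re_placesZeta_pos_at μG hΨc (exists_gjTestFunctionG_eq hΦ01 𝔫) (gjTestFunctionG_one hΦ1 𝔫)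
      hN hφ0 s₀ hsupp
    rw [h, Complex.zero_re] at hpos
    exact lt_irrefl _ hpos
  refine ⟨Z, A, hZ, hAd, hA0, fun s hs => ?_⟩
  -- the unfolding identity for `re s ≥ 4`
  have hs' : ((1 : ℕ) : ℝ) * (1 : ℕ) + (1 : ℕ) + 2 ≤ s.re := by norm_num; linarith
  have hcard : ∀ v : HeightOneSpectrum (𝓞 K), v ∉ T → Multiset.card (γ v) = 1 := by
    intro v hv
    obtain ⟨𝔪, -, -, ϖ, hsat⟩ := hγ v (fun h => hv (Finset.mem_coe.1 h))
    exact hsat.card_eq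
  have hmain := gjZeta_awayProductMeasure_eq μH μG P hγ hφP hφ0 hφT φ hs' Φ
    (fun a : placesFactor K 1 T => Ψ (a : GL (Fin 1) (AdeleRing (𝓞 K) K)))
    (fun h a => gjTestFunction_mul Φinf h𝔫 h a) (continuous_gjTestFunction Φinf h𝔫)
    (integrable_norm_mul_adelicAbsDet_rpow μG hΨc hN hΨN s.re)
  have e : s + (((1 : ℕ) : ℂ) - 1) / 2 = s := by push_cast; ring
  have hbridge : ∀ i : {w : HeightOneSpectrum (𝓞 K) // w ∉ T}, localEulerInv 1 (γ i.1) i.1 s =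
      ((eulerPolynomial (γ i.1)).eval ((i.1.residueCard : ℂ) ^ (-s)))⁻¹ := fun i => by
    have h := localEulerInv_eq_inv_eval (hcard i.1 i.2) i.1 s
    rwa [e] at h
  have hmult : Multipliable fun i : {w : HeightOneSpectrum (𝓞 K) // w ∉ T} =>
      ((eulerPolynomial (γ i.1)).eval ((i.1.residueCard : ℂ) ^ (-s)))⁻¹ :=
    ((hasSum_unfoldTerm_intCosetsAway P hγ hφP hφ0 hφT φ hs').1).congr hbridge
  have hsplit := partialStandardL_eq_prod_mul_tprod (Finset.Subset.refl T) γ s hmult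
  rw [Finset.sdiff_self, Finset.prod_empty, one_mul] at hsplit
  have htprod : (∏' i : {w : HeightOneSpectrum (𝓞 K) // w ∉ T}, localEulerInv 1 (γ i.1) i.1 s) =
      partialStandardL (↑T : Set (HeightOneSpectrum (𝓞 K))) γ s := by
    rw [hsplit]
    exact tprod_congr hbridge
  rw [hZeq s hs]
  change gjZeta μ m Φ φ φ s = A s * partialStandardL (↑T : Set (HeightOneSpectrum (𝓞 K))) γ s
  rw [hm, hmain.2, htprod, hA]
  simp only [placesZeta]
  ring

/-- **Hecke–Tate for `GL_1`, from Godement–Jacquet in rank one: the partial standard `L`-function of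
a non-trivial cuspidal automorphic representation of `GL_1(𝔸_K)` is entire.** For `Π` cuspidal of
`GL_1(𝔸_K)` with Hecke character `χ_Π ≠ 1` (a unitary idele class character trivial on `A_G`), every
finite set `S` of finite places and every honest Satake family `γ` of `Π` off `S`,
`L^S(s, Π) = ∏_{v ∉ S} (1 - χ_Π(ϖ_v) q_v^{-s})⁻¹` extends from `Re s > 1` to an entire function
(Tate (1967), Thm. 4.4.1, the case "`c` non-trivial on `J`"; Hecke (1920)). Proof: for every `t ∈ ℂ`
the zeta quotient `Z_t = A_t · L^S` of `exists_entire_eq_mul_partialStandardL_fin_one` with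
`A_t(t) ≠ 0` (data `exists_unfolding_data_at`: the vector `φ ∈ Π` is `K^S`-fixed because `χ_Π` is
unramified off `S`, `rightRegular_apply_eq_self_of_mem_awayLevel`, and `∫_X φ = 0`,
`integral_eq_zero_of_heckeCharacter_ne_one`); the entire functions `Z_t A_{t'}` and `Z_{t'} A_t`
agree on `Re s > 4`, hence everywhere, so `s ↦ Z_s(s)/A_s(s)` is entire and equals `L^S` on
`Re s > 4`, hence on `Re s > 1` (`L^S` is holomorphic there,
`differentiableOn_partialStandardL_of_summable` with Jacquet–Shalika's (5.3.3)).
[cite: TateThesis1967, Thm. 4.4.1] [cite: GodementJacquet1972, Thm. 13.8] -/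
theorem hasEntireContinuation_partialStandardL_gl_one (P : CuspidalAutomorphicRepGL 1 K μ)
    (hP : P.heckeCharacter ≠ 1) (S : Finset (HeightOneSpectrum (𝓞 K))) {γ : SatakeFamily K}
    (hγ : IsSatakeFamilyOf P (↑S : Set (HeightOneSpectrum (𝓞 K))) γ) :
    GaloisRepresentations.LFunction.HasEntireContinuation
      (partialStandardL (↑S : Set (HeightOneSpectrum (𝓞 K))) γ) := by
  -- a non-zero vector of `Π`, its invariance and its mean
  obtain ⟨f, hf0⟩ := GLOne.exists_ne_zero P.isTopIrreducible
  set φ : (AdelicGroupData.gl 1 K).L2 μ := (f : (AdelicGroupData.gl 1 K).L2 μ) with hφdef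
  have hφP : φ ∈ P.1 := f.2
  have hφ0 : φ ≠ 0 := fun h => hf0 (Subtype.ext h)
  have hur : ∀ v ∉ S, P.heckeCharacter.IsUnramifiedAt v := fun v hv =>
    hγ.isUnramifiedAt_heckeCharacter fun h => hv (Finset.mem_coe.1 h)
  have hfix : ∀ v ∉ S, ∀ x ∈ valuedCongruenceSubgroup (Fin 1) (1 : WithZero (Multiplicative ℤ)),
      (AdelicGroupData.gl 1 K).rightRegular μ (GLn.ofLocal 1 K v x) φ = φ := fun v hv x hx =>
    P.rightRegular_ofLocal_apply_eq_self (hur v hv) hx hφP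
  have h0 := P.integral_eq_zero_of_heckeCharacter_ne_one hP hφP
  -- for every point, an entire zeta quotient `Z = A · L^S` with `A` non-vanishing there
  have hpt : ∀ t : ℂ, ∃ Z A : ℂ → ℂ, Differentiable ℂ Z ∧ Differentiable ℂ A ∧ A t ≠ 0 ∧
      ∀ s : ℂ, (4 : ℝ) < s.re → Z s = A s * partialStandardL (↑S : Set (HeightOneSpectrum (𝓞 K))) γ s := by
    intro t
    obtain ⟨𝔫, h𝔫, Φinf, N, hT, hΦ01, hΦ1, hN, hsupp⟩ := exists_unfolding_data_at S hφ0 hfix t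
    subst hT
    exact exists_entire_eq_mul_partialStandardL_fin_one P h𝔫 hγ hφP hφ0
      (P.rightRegular_apply_eq_self_of_mem_awayLevel _ hur hφP) h0 hΦ01 hΦ1 hN t hsupp
  choose Z A hZ hA hA0 hZA using hpt
  -- the cross identity `Z_t A_{t'} = Z_{t'} A_t` on all of `ℂ`
  have h5 : (4 : ℝ) < ((5 : ℝ) : ℂ).re := by rw [Complex.ofReal_re]; norm_num
  have hV : {s : ℂ | (4 : ℝ) < s.re} ∈ 𝓝 ((5 : ℝ) : ℂ) :=
    (isOpen_lt continuous_const Complex.continuous_re).mem_nhds h5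
  have hcross : ∀ t t' s : ℂ, Z t s * A t' s = Z t' s * A t s := by
    intro t t'
    have hf : AnalyticOnNhd ℂ (fun s => Z t s * A t' s) Set.univ :=
      ((hZ t).mul (hA t')).differentiableOn.analyticOnNhd isOpen_univ
    have hg : AnalyticOnNhd ℂ (fun s => Z t' s * A t s) Set.univ :=
      ((hZ t').mul (hA t)).differentiableOn.analyticOnNhd isOpen_univ
    have heq : (fun s => Z t s * A t' s) =ᶠ[𝓝 ((5 : ℝ) : ℂ)] fun s => Z t' s * A t s := by
      filter_upwards [hV] with s hs
      rw [hZA t s hs, hZA t' s hs]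
      ring
    have h := hf.eqOn_of_preconnected_of_eventuallyEq hg isPreconnected_univ (Set.mem_univ _) heq
    exact fun s => h (Set.mem_univ s)
  -- the continuation `g(s) = Z_s(s) / A_s(s)`
  set g : ℂ → ℂ := fun s => Z s s / A s s with hgdef
  have hloc : ∀ t : ℂ, g =ᶠ[𝓝 t] fun s => Z t s / A t s := by
    intro t
    filter_upwards [(hA t).continuous.continuousAt.eventually_ne (hA0 t)] with s hs
    show Z s s / A s s = Z t s / A t s
    rw [div_eq_div_iff (hA0 s) hs]
    exact hcross s t s
  have hgd : Differentiable ℂ g := fun t =>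
    (((hZ t) t).div ((hA t) t) (hA0 t)).congr_of_eventuallyEq (hloc t)
  refine ⟨g, hgd, fun s hs => ?_⟩
  -- agreement with `L^S` on `re s > 4`, then on `re s > 1` by the identity theorem
  have h4 : ∀ s : ℂ, (4 : ℝ) < s.re → g s = partialStandardL (↑S : Set (HeightOneSpectrum (𝓞 K))) γ s :=
    fun s hs => by
      show Z s s / A s s = _
      rw [hZA s s hs, mul_div_cancel_left₀ _ (hA0 s)]
  have h₂ := summable_normSq_trace_satakePow_holds (n := 1) (K := K) (μ := μ)
  set U : Set ℂ := {z : ℂ | 1 < z.re} with hU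
  have hUo : IsOpen U := isOpen_lt continuous_const Complex.continuous_re
  have hUc : IsPreconnected U := (convex_halfSpace_re_gt (1 : ℝ)).isPreconnected
  have hgU : AnalyticOnNhd ℂ g U := hgd.differentiableOn.analyticOnNhd hUo
  have hLU : AnalyticOnNhd ℂ (partialStandardL (↑S : Set (HeightOneSpectrum (𝓞 K))) γ) U :=
    (differentiableOn_partialStandardL_of_summable h₂ P hγ).analyticOnNhd hUo
  have hz₀ : ((5 : ℝ) : ℂ) ∈ U := by
    show 1 < ((5 : ℝ) : ℂ).re
    rw [Complex.ofReal_re]; norm_num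
  have hev : g =ᶠ[𝓝 ((5 : ℝ) : ℂ)] partialStandardL (↑S : Set (HeightOneSpectrum (𝓞 K))) γ := by
    filter_upwards [hV] with s hs using h4 s hs
  exact hgU.eqOn_of_preconnected_of_eventuallyEq hLU hUc hz₀ hev hs

/-- **Hecke's theorem for the characters of `L²(GL_1)`**, in the shape consumed by the rank-one
reductions of the tree: for a unitary Hecke character `ψ ≠ 1` of `K` trivial on `A_G = ℝ_{>0}` and a
finite `S` off which `ψ` is unramified, the partial Hecke `L`-function
`L^S(s, ψ) = ∏_{v ∉ S} (1 - ψ(ϖ_v) q_v^{-s})⁻¹` extends to an entire function. (`ψ` is the Hecke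
character of a cuspidal `Π ≤ L²(μ)` of `GL_1(𝔸_K)`, `CuspidalAutomorphicRepGL.exists_heckeCharacter_eq`,
with honest Satake family `{ψ(ϖ_v)}` off `S`; the auxiliary automorphic measure `μ` only serves
to realise `ψ`.) Tate (1967), Thm. 4.4.1; Hecke (1920). [cite: TateThesis1967, Thm. 4.4.1] -/
theorem exists_entire_eq_partialHeckeL (μ : Measure (AdelicGroupData.gl 1 K).automorphicQuotient)
    [(AdelicGroupData.gl 1 K).IsAutomorphicMeasure μ]
    (ψ : GaloisRepresentations.HeckeCharacter K) (hu : ψ.IsUnitary)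
    (hA : ∀ t : ℝ≥0ˣ, ψ (posRealIdele K t) = 1) (h1 : ψ ≠ 1)
    {S : Set (HeightOneSpectrum (𝓞 K))} (hS : S.Finite) (hur : ∀ v ∉ S, ψ.IsUnramifiedAt v) :
    ∃ g : ℂ → ℂ, Differentiable ℂ g ∧ ∀ s : ℂ, 1 < s.re →
      g s = ∏' v : {v : HeightOneSpectrum (𝓞 K) // v ∉ S},
        (1 - ψ.valueAtUniformizer v.1 * ((v.1.residueCard : ℂ) ^ (-s)))⁻¹ := by
  obtain ⟨T, rfl⟩ : ∃ T : Finset (HeightOneSpectrum (𝓞 K)), (T : Set _) = S := ⟨hS.toFinset, hS.coe_toFinset⟩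
  -- realise `ψ` by a cuspidal `Π` of `GL_1`, with honest Satake family `{ψ(ϖ_v)}` off `S`
  obtain ⟨P, hPψ, hfix⟩ := CuspidalAutomorphicRepGL.exists_heckeCharacter_eq (μ := μ) ψ hu hA
  have hγ : IsSatakeFamilyOf P (↑T : Set (HeightOneSpectrum (𝓞 K))) fun v => {ψ.valueAtUniformizer v} := by
    intro v hv
    obtain ⟨𝔪, h𝔪, hv𝔪, hχ𝔪⟩ :=
      GaloisRepresentations.HeckeCharacter.exists_level_not_dvd_of_isUnramifiedAt 1 (hur v hv)
    obtain ⟨f, hf, hf0⟩ := hfix (principalCongruenceLevel 1 K 𝔪) hχ𝔪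
    refine ⟨𝔪, h𝔪, hv𝔪, GaloisRepresentations.HeckeCharacter.uniformizer K v, ?_⟩
    have key := GLOne.hasSatakeParameterAt_of_mem_fixedVectors P.isTopIrreducible hf hf0 v
      (GaloisRepresentations.HeckeCharacter.valued_uniformizer v)
    have hval : ((GLOne.heckeCharacter P.isTopIrreducible
        (GaloisRepresentations.localUnits v (GaloisRepresentations.HeckeCharacter.uniformizer K v)) : ℂˣ) : ℂ) =
        ψ.valueAtUniformizer v := by
      change ((P.heckeCharacter _ : ℂˣ) : ℂ) = _
      rw [hPψ, GaloisRepresentations.HeckeCharacter.valueAtUniformizer,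
        GaloisRepresentations.HeckeCharacter.localComponent_apply]
    rwa [hval] at key
  have hP1 : P.heckeCharacter ≠ 1 := hPψ ▸ h1
  obtain ⟨g, hg, hgL⟩ := hasEntireContinuation_partialStandardL_gl_one P hP1 T hγ
  refine ⟨g, hg, fun s hs => ?_⟩
  rw [hgL s hs, CuspidalAutomorphicRepGL.partialStandardL_eq_tprod_heckeCharacter hγ, hPψ]

/-- **Mœglin–Waldspurger, Corollaire (i)(b) for `GL_1` over every number field `K`,
unconditionally.** The named fact `MoeglinWaldspurger1989_partialPairL_entire_of_ne_conj` holds for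
`n = 1` over `K`: for cuspidal `π, π' ≤ L²_cusp(GL_1(K) A_G \ GL_1(𝔸_K))` with `π ≠ π̄'` and honest
Satake families off a finite `S`, `L^S(s, π × π') = L^S(s, χ_π χ_{π'})` extends to an entire function —
`MoeglinWaldspurger1989_partialPairL_entire_of_ne_conj_one_of_heckeCharacter` fed with Hecke's theorem
`exists_entire_eq_partialHeckeL`, now a theorem of the tree (Godement–Jacquet in rank one). In print:
for `n = n' = 1` condition (b) reads `χ_π χ_{π'} ≠ |·|^t` for all `t`, and `L(s, χ_π χ_{π'})` is Hecke's
entire `L`-function. This supersedes the conditional `…_one_of_tate` and the case `K = ℚ`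
(`…_one_rat`). [cite: MoeglinWaldspurger1989, Appendice, Corollaire (i)(b), p. 667]
[cite: TateThesis1967, Thm. 4.4.1] -/
theorem MoeglinWaldspurger1989_partialPairL_entire_of_ne_conj_one :
    MoeglinWaldspurger1989_partialPairL_entire_of_ne_conj (n := 1) (K := K) (μ := μ) :=
  MoeglinWaldspurger1989_partialPairL_entire_of_ne_conj_one_of_heckeCharacter
    fun ψ hu hA h1 _ hS hur => exists_entire_eq_partialHeckeL μ ψ hu hA h1 hS hur

end RankOneEntire

end Literature.NumberTheory.Automorphic
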